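import Literature.Probability.LatticeModels.CurrentsEdgeAvoidance
import Literature.Probability.LatticeModels.IsingTranslationInvariance
import HarnessLib

/-!
# Translation invariance of the edge-avoidance limits of the random currents

Trunk G02 (T-STATMECH), topic `Probability/LatticeModels`, namespace `Literature.StatMech`. The limits
`lim_L P̂^#_{Λ_L,β}[n ≡ 0 on T]` of `CurrentsEdgeAvoidance.lean` (`plusCurrentAvoidLimit`,
`freeCurrentAvoidLimit`; ADS15 (2.14): explicit finite combinations of the infinite-volume
correlations `⟨σ_A⟩⁺_β`, `⟨σ_A⟩⁰_β`) are invariant under translating the edge set `T`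
(`plusCurrentAvoidLimit_image_pairShift`, `freeCurrentAvoidLimit_image_pairShift`), because the
correlations are (`plusCorr_shift`, `freeCorr_shift`, `IsingTranslationInvariance.lean`). This is
the computation behind R2 of

* M. Aizenman, H. Duminil-Copin, V. Sidoravicius, *Random currents and continuity of Ising
  model's spontaneous magnetization*, Comm. Math. Phys. **334** (2015), proof of Thm. 2.3, R2
  (arXiv v3, p. 9): "The limit of the probability of the event `𝒞_E` … is the same if the sequence
  `(Λ_L)` is replaced by the sequence `(x + Λ_L)`. (Simply use (2.14) and the convergence of
  `⟨⋯⟩^#_{x+Λ_L,β}` to `⟨⋯⟩^#_β`.)"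

(the translation invariance of the infinite-volume double current itself is assembled in
`DoubleCurrentsShift.lean`). Here `pairShift d v : s(x,y) ↦ s(x+v, y+v)` is the translation of
bonds and `bondsSupport d S` the set `A(S)` of odd-degree vertices of `S`.

## Mathlib status

Anchors: `Sym2.map`, `Finset.image`, `Finset.powerset_image`, `Finset.fold_image`,
`Finset.fold_hom`, `Finset.image_symmDiff`; tree: `plusCorr_shift`, `freeCorr_shift`
(`IsingTranslationInvariance.lean`), `zdGraph_adj_shift_iff` (`BondPercolationSymmetry.lean`).
-/

noncomputable section

open MeasureTheory Filter Topology Finset Literature.Probability.LatticeModels Literature.Probability.Percolation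
open scoped symmDiff

namespace Literature.Probability.LatticeModels

variable (d : ℕ)

/-! ### Translating pairs, bonds and their supports -/

/-- Translation of unordered pairs of sites by `v`: `{x,y} ↦ {x+v, y+v}`. [folklore] -/
def pairShift (v : Site d) (e : Sym2 (Site d)) : Sym2 (Site d) := Sym2.map (Site.shift v) e

/-- `pairShift v s(x,y) = s(x+v, y+v)`. [folklore] -/
@[simp] theorem pairShift_mk (v x y : Site d) : pairShift d v s(x, y) = s(x + v, y + v) := rfl

/-- Translation of pairs is injective. [folklore] -/
theorem pairShift_injective (v : Site d) : Function.Injective (pairShift d v) :=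
  Sym2.map.injective (Site.shift v).injective

/-- Translating by `v` and then by `-v` (or conversely) is the identity. [folklore] -/
theorem pairShift_neg_pairShift (v : Site d) (e : Sym2 (Site d)) : pairShift d (-v) (pairShift d v e) = e := by
  induction e using Sym2.ind with
  | _ x y => simp [pairShift_mk]

/-- Lattice bonds are translated to lattice bonds. [folklore] -/
theorem pairShift_mem_edgeSet_iff (v : Site d) (e : Sym2 (Site d)) :
    pairShift d v e ∈ (zdGraph d).edgeSet ↔ e ∈ (zdGraph d).edgeSet := by
  induction e using Sym2.ind with
  | _ x y =>
    rw [pairShift_mk, SimpleGraph.mem_edgeSet, SimpleGraph.mem_edgeSet]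
    exact zdGraph_adj_shift_iff v x y

/-- Translating a pair translates its set of endpoints. [folklore] -/
theorem toFinset_pairShift (v : Site d) (e : Sym2 (Site d)) :
    (pairShift d v e).toFinset = e.toFinset.image (Site.shift v) := by
  induction e using Sym2.ind with
  | _ x y =>
    rw [pairShift_mk, Sym2.toFinset_mk_eq, Sym2.toFinset_mk_eq, Finset.image_insert, Finset.image_singleton]
    rfl

/-- Translating bonds translates their support: `A(S + v) = A(S) + v`. [folklore] -/
theorem bondsSupport_image_pairShift (v : Site d) (S : Finset (Sym2 (Site d))) :
    bondsSupport d (S.image (pairShift d v)) = (bondsSupport d S).image (Site.shift v) := by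
  unfold bondsSupport
  rw [Finset.fold_image (fun x _ y _ h => pairShift_injective d v h)]
  have hcomp : ((fun e : Sym2 (Site d) => e.toFinset) ∘ pairShift d v) =
      fun e => (e.toFinset).image (Site.shift v) := by
    funext e; exact toFinset_pairShift d v e
  rw [hcomp]
  have h := Finset.fold_hom (s := S) (b := (∅ : Finset (Site d))) (f := fun e : Sym2 (Site d) => e.toFinset)
    (op := fun s t : Finset (Site d) => s ∆ t) (op' := fun s t : Finset (Site d) => s ∆ t)
    (m := fun s : Finset (Site d) => s.image (Site.shift v))
    (fun x y => Finset.image_symmDiff _ _ (Site.shift v).injective)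
  rw [Finset.image_empty] at h
  exact h

/-- `plusCorr` is invariant under translating the index set (image form). [cite: FriedliVelenik2017, Thm. 3.17] -/
theorem plusCorr_image_shift {β h : ℝ} (hβ : 0 ≤ β) (hh : 0 ≤ h) (v : Site d) (A : Finset (Site d)) :
    plusCorr d β h (A.image (Site.shift v)) = plusCorr d β h A := by
  have hA : A.image (Site.shift v) = A.map (Site.shift v).toEmbedding :=
    (Finset.map_eq_image (Site.shift v).toEmbedding A).symm
  rw [hA]
  exact plusCorr_shift d hβ hh v A

/-- `freeCorr` is invariant under translating the index set (image form). [cite: FriedliVelenik2017, Exercise 3.16, p. 115] -/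
theorem freeCorr_image_shift {β h : ℝ} (hβ : 0 ≤ β) (hh : 0 ≤ h) (v : Site d) (A : Finset (Site d)) :
    freeCorr d β h (A.image (Site.shift v)) = freeCorr d β h A := by
  have hA : A.image (Site.shift v) = A.map (Site.shift v).toEmbedding :=
    (Finset.map_eq_image (Site.shift v).toEmbedding A).symm
  rw [hA]
  exact freeCorr_shift d hβ hh v A

/-! ### Translation invariance of the limit laws -/

/-- Sums over the subsets of a translated set of pairs. [folklore] -/
theorem sum_powerset_image_pairShift (v : Site d) (T : Finset (Sym2 (Site d))) (f : Finset (Sym2 (Site d)) → ℝ) :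
    ∑ S ∈ (T.image (pairShift d v)).powerset, f S = ∑ S ∈ T.powerset, f (S.image (pairShift d v)) := by
  rw [Finset.powerset_image, Finset.sum_image]
  intro x _ y _ h
  exact Finset.image_injective (pairShift_injective d v) h

/-- `lim_L P̂⁺_{Λ_L,β}[n ≡ 0 on T]` is translation invariant (`β ≥ 0`). [cite: AizenmanDuminilCopinSidoraviciusCMP2015, Thm. 2.3 (R2), proof] -/
theorem plusCurrentAvoidLimit_image_pairShift {β : ℝ} (hβ : 0 ≤ β) (v : Site d) (T : Finset (Sym2 (Site d))) :
    plusCurrentAvoidLimit d β (T.image (pairShift d v)) = plusCurrentAvoidLimit d β T := by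
  unfold plusCurrentAvoidLimit
  rw [sum_powerset_image_pairShift, Finset.card_image_of_injective _ (pairShift_injective d v)]
  refine Finset.sum_congr rfl fun S _ => ?_
  rw [Finset.card_image_of_injective _ (pairShift_injective d v), bondsSupport_image_pairShift,
    plusCorr_image_shift d hβ le_rfl]

/-- `lim_L P̂⁰_{Λ_L,β}[n ≡ 0 on T]` is translation invariant (`β ≥ 0`). [cite: AizenmanDuminilCopinSidoraviciusCMP2015, Thm. 2.3 (R2), proof] -/
theorem freeCurrentAvoidLimit_image_pairShift {β : ℝ} (hβ : 0 ≤ β) (v : Site d) (T : Finset (Sym2 (Site d))) :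
    freeCurrentAvoidLimit d β (T.image (pairShift d v)) = freeCurrentAvoidLimit d β T := by
  unfold freeCurrentAvoidLimit
  rw [sum_powerset_image_pairShift, Finset.card_image_of_injective _ (pairShift_injective d v)]
  refine Finset.sum_congr rfl fun S _ => ?_
  rw [Finset.card_image_of_injective _ (pairShift_injective d v), bondsSupport_image_pairShift,
    freeCorr_image_shift d hβ le_rfl]

end Literature.Probability.LatticeModels
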